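import Literature.Analysis.FluidPDE.SelfSimilarLiouville
import Literature.Analysis.FluidPDE.PineauVicolRSS
import Literature.Analysis.FluidPDE.WholeSpaceIBP
import HarnessLib

/-!
# Barrier: no Leray (backward) self-similar blow-up (Nečas–Růžička–Šverák 1996, Tsai 1998)

Barrier catalogue entry for `NavierStokesRegularity` (D-0021), on the NEGATIVE side (routes aiming
at `¬ NavierStokesRegularity` / Clay (C)). The three exclusion theorems are already vendored as the
named facts `Literature.Analysis.FluidPDE.necas_ruzicka_sverak`, `Literature.Analysis.FluidPDE.tsai_selfsimilar`,
`Literature.Analysis.FluidPDE.tsai_selfsimilar_local_energy` (`Literature/Analysis/FluidPDE/SelfSimilarLiouville.lean`,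
stated there for `C²` profile pairs `(U, P)` solving Leray's system, accepted
`Literature.Analysis.FluidPDE.IsLerayProfile` — a specialisation of the printed weak-solution setting); this file
records their conjunction under `Literature/Barriers/NavierStokesRegularity/` with the structured
barrier docstring that the gate indexes, and proves nothing new except the projections.

## What is printed

* Leray (1934) proposed singular solutions of the form
  `u(x,t) = (2a(T-t))^{-1/2} U(x / √(2a(T-t)))`, `p = (2a(T-t))^{-1} P(·)`, where `(U, P)`
  solves the profile system `-νΔU + aU + a(y·∇)U + (U·∇)U + ∇P = 0`, `div U = 0` on `ℝ³`
  (NRŠ (1.1)–(1.3); Tsai (1.1)–(1.3)).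
* J. Nečas, M. Růžička, V. Šverák, Acta Math. 176 (1996), 283–294, Theorem 1 (p. 291): the only
  weak solution `U ∈ L³(ℝ³)` of (1.3) is `U ≡ 0`. (§1: `U ∈ L³` holds whenever `u` has finite
  kinetic energy and satisfies the global energy inequality; the case of merely LOCAL energy
  estimates was left open there.)
* T.-P. Tsai, Arch. Rational Mech. Anal. 143 (1998), 29–51, Theorem 1: a weak solution `U` of (1.3)
  in `L^q(ℝ³)`, `q ∈ (3, ∞]`, is constant (hence `0` if `q < ∞`); Theorem 2: if `u` of the form
  (1.2)₁ is a weak solution of Navier–Stokes satisfying the local energy estimates (1.4) in the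
  cylinder `B₁(0) × (T-1, T)`, then `u ≡ 0`. (Note: the in-tree docstrings of `tsai_selfsimilar`
  and `tsai_selfsimilar_local_energy` interchange these two theorem numbers; the statements
  themselves are the printed ones.)
* Tsai, §1: "The known regularity criteria … do not apply to self-similar singularities";
  "more complicated singularities may possibly exist".

## Audit 2026-08-16 (D-0021): what the technique class really covers

The three theorems concern Leray's NON-ROTATED ansatz only. Composing the scaling with a rotation
at constant angular speed in logarithmic time gives the *rotated self-similar* (RSS) ansatz
proposed by G. Perelman, `u(x,t) = (−t)^{−1/2} R(αs) U(R(−αs)x/√(−t))`, `s = −log(−t)`, `α ≠ 0`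
— an equally exact symmetry reduction, with the STATIONARY profile system
`α(JU − (Jy·∇)U) + ½U + ½(y·∇)U − ΔU + (U·∇)U + ∇P = 0`, `div U = 0` (Bradshaw–Tsai 2017,
Appendix §5; Pineau–Vicol 2026, (1.7)–(1.8)). For `α ≠ 0` the head pressure `Π` no longer obeys
a maximum principle ("for the above system with `α ≠ 0`, there does not seem an analogue
quantity of `Λ` that satisfies the maximal principle", Bradshaw–Tsai 2017, Appendix §5; "the
antisymmetric rotation terms … destroy this structure … no Liouville theorem has so far been
available for rotated self-similar solutions, when `α ≠ 0`", Pineau–Vicol 2026, §1.2 p. 4; indeed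
for the displayed system, with `b = U + ½y − αJy` and `Π_α = ½|U|² + P + (½y − αJy)·U`, one finds
`−ΔΠ_α + b·∇Π_α = −|curl U|² + 2α e₃·curl U`, an indefinite right-hand side), and the
non-existence of such profiles with the Type I decay `|U(y)| ≤ C/(1+|y|)` is an OPEN conjecture
(Bradshaw–Tsai 2017, Appendix §5, Open Problems 5.1–5.2; Tsai, GSM 192, Conj. 8.9 as reported by
Pineau–Vicol 2026, Conjecture 1.1), settled only for `|α| ≪ 1` and `|α| ≫ 1` relative to `C`
(Pineau–Vicol 2026, Thm. 1.4 — vendored as the named fact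
`Literature.Analysis.FluidPDE.pineauVicol2026_rss_liouville`, discharged in the tree:
`Literature.Analysis.FluidPDE.pineauVicol2026_rss_liouville_holds`, `PineauVicolRSSHolds.lean`;
its `α = 0` slice is also the tree theorem
`Literature.Analysis.FluidPDE.pineauVicol2026_rss_liouville_alpha_zero`) and for profiles
`U ∈ L³` (then `u ∈ L^∞_t L³_x`, Escauriaza–Seregin–Šverák 2003; Bradshaw–Tsai 2017, Appendix §5:
"but it does not imply the result of [Tsai-ARMA]"). In particular every finite-energy,
finite-dissipation EXACTLY (rotated-)self-similar slab has `U ∈ H¹ ⊂ L³` (the computation of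
NRŠ 1996, §1, is blind to the rotation) and is excluded for every `α`; what stays open is the
Type-I / local-energy rotated profile `|U| ~ C/|y|`, i.e. the exact local model of a putative
finite-energy singularity — the rotated twin of the class (1.5)–(1.6) that Tsai's theorems close
for `α = 0` (Tsai 1998, §1 p. 31). The corrected catalogue entry is
`LeraySelfSimilarBlowupExclusionNarrow` (last section): the conjunction of this entry with
Pineau–Vicol's theorem, whose structured block records the open rotated range as the known
evasion; both of its conjuncts are theorems of the tree
(`LeraySelfSimilarBlowupExclusionNarrow_holds`, Proofs companion
`LeraySelfSimilarBlowupExclusionProofs.lean`). The technique-class tokens of the original entry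
are kept for indexing; its
`scope_caveats` (e)–(f) and `evasions_known` were extended by the audit.

## References

* J. Nečas, M. Růžička, V. Šverák, Acta Math. 176 (1996), 283–294. [`NecasRuzickaSverak1996`]
* T.-P. Tsai, Arch. Rational Mech. Anal. 143 (1998), 29–51. [`Tsai1998`]
* D. Chae, Math. Ann. 338 (2007), 435–449 (asymptotically self-similar singularities). [`Chae2007`]
* D. Chae, J. Wolf, Comm. PDE 42 (2017), 1359–1374 (discretely self-similar). [`ChaeWolf2017RemovingDSS`]
* T. Y. Hou, Found. Comput. Math. 23 (2023) (numerics: nearly self-similar scenario). [`Hou2022PotentiallySingularNS`]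
* G. Koch, N. Nadirashvili, G. Seregin, V. Šverák, Acta Math. 203 (2009). [`KochNadirashviliSereginSverak2009`]
* H. Jia, V. Šverák, Invent. Math. 196 (2014) (forward self-similar solutions exist). [`JiaSverak2014`]
* B. Pineau, V. Vicol, arXiv:2607.09619 (2026) (rotated backward self-similar solutions: Conj. 1.1,
  Thms. 1.4, 1.6–1.7). [`PineauVicol2026`]
* Z. Bradshaw, T.-P. Tsai, Comm. PDE 42 (2017) 1065–1087 = arXiv:1610.05680, Appendix §5 (Open
  Problems 5.1–5.3). [`BradshawTsai2017CPDE`]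
* T.-P. Tsai, *Lectures on Navier–Stokes equations*, GSM 192 (2018), Conj. 8.8–8.9 (not held;
  as reported by Pineau–Vicol 2026). [`Tsai2018`]
* L. Escauriaza, G. Seregin, V. Šverák, Russian Math. Surveys 58 (2003) 211–250. [`ESS2003`]
-/

noncomputable section

open scoped Laplacian InnerProductSpace RealInnerProductSpace

namespace Literature.Barriers.NavierStokesRegularity

/-- **Barrier (Nečas–Růžička–Šverák 1996; Tsai 1998): Leray's backward self-similar blow-up
does not occur.** Let `ν > 0`, `a > 0` and let `(U, P)` solve Leray's profile system
`-νΔU + aU + a(y·∇)U + (U·∇)U + ∇P = 0`, `div U = 0` on `ℝ³` (accepted `Literature.Analysis.FluidPDE.IsLerayProfile`,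
so that `u = Literature.Fluid.lerayBackward a T U` is a self-similar solution blowing up at `(0, T)`).
Then `U ≡ 0` in each of the following cases: (i) `U ∈ L³(ℝ³)`
[cite: NecasRuzickaSverak1996, Thm. 1 (p. 291)]; (ii) `U ∈ L^q(ℝ³)` for some `3 < q < ∞`
[cite: Tsai1998, Thm. 1]; (iii) `u` satisfies the local energy estimates
`sup_{t₀<t<T} ∫_{B₁} |u|² < ∞`, `∫_{t₀}^T ∫_{B₁} |∇u|² < ∞` near the singularity, as every
Leray–Hopf solution does [cite: Tsai1998, Thm. 2]. This declaration is the conjunction of the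
in-tree named facts `Literature.Analysis.FluidPDE.necas_ruzicka_sverak`, `Literature.Analysis.FluidPDE.tsai_selfsimilar`,
`Literature.Analysis.FluidPDE.tsai_selfsimilar_local_energy` (which specialise the printed weak profiles to `C²` ones).

BARRIER (structured block, D-0021):
technique_class: self-similar-blowup-ansatz leray-backward-self-similar-profile exact-self-similar-scenario blowup-construction
blocks: the negation ¬NavierStokesRegularity (Clay (C)-type breakdown from finite-energy data) via Leray's 1934 proposal of an EXACTLY self-similar singularity `u = (2a(T-t))^{-1/2} U(x/√(2a(T-t)))`: no such singularity has finite energy with the global energy inequality (`U ∈ L³`) [cite: NecasRuzickaSverak1996, Thm. 1 (p. 291) and §1], a profile in `L^q`, `3 < q ≤ ∞` [cite: Tsai1998, Thm. 1], or even just local energy estimates near the singular point [cite: Tsai1998, Thm. 2]; in particular a certified-numerics route positing an exactly self-similar viscous profile of locally finite energy is void.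
because: for `U ∈ L³` the quantity `Π = |U|²/2 + P + a y·U` satisfies `-νΔΠ + (U + a y)·∇Π = -ν|curl U|² ≤ 0`, a maximum principle forces `Π` constant and then `U = 0` [cite: NecasRuzickaSverak1996, §3 and Thm. 1]; under local energy estimates Tsai shows the self-similar `u` is a suitable weak solution, applies Caffarelli–Kohn–Nirenberg partial regularity to get the growth bounds (1.10) on `U`, and concludes with a Liouville-type lemma for `Π` [cite: Tsai1998, §1 (plan of proof), Thms. 1–2].
evasions_known: singularity models NOT of exact backward self-similar form: discretely self-similar (DSS) blow-up is excluded only for scaling factors `λ` close to `1` under the bound `|u| ≤ C_*/(√(-t)+|x|)` [cite: ChaeWolf2017RemovingDSS, Thms. 1.1, 1.3], asymptotically self-similar blow-up (convergence of the rescaled solution to a profile in `L^p`, `p ≥ 3`, or locally in `L^q`) is excluded by [cite: Chae2007, Thms. 1.4–1.5]; general Type II (non-self-similar-rate) singularities are untouched, and any axisymmetric singularity must already be Type II [cite: KochNadirashviliSereginSverak2009, §1 and Thm. 6.2]; the numerically observed candidate is only "nearly self-similar" with drifting scaling exponents [cite: Hou2022PotentiallySingularNS, §1]; (audit 2026-08-16)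 the ROTATED exact self-similar ansatz of Perelman, `u(x,t) = (−t)^{−1/2} R(αs) U(R(−αs)x/√(−t))`, `s = −log(−t)`, `α ≠ 0` (stationary profile system `α(JU − (Jy·∇)U) + ½U + ½(y·∇)U − ΔU + (U·∇)U + ∇P = 0`), is NOT covered by these theorems — the head-pressure maximum principle fails for `α ≠ 0` [cite: BradshawTsai2017CPDE, Appendix §5 (after Open Problem 5.2)] [cite: PineauVicol2026, §1.2 p. 4]; it is excluded for `U ∈ L³` (`u ∈ L^∞_t L³_x`) [cite: BradshawTsai2017CPDE, Appendix §5] and, under the Type I bound `|U(y)| ≤ C/(1+|y|)`, for `|α| < α_(C)` or `|α| > ᾱ(C)` [cite: PineauVicol2026, Theorem 1.4 (arXiv:2607.09619 p. 4)] (named fact `Literature.Analysis.FluidPDE.pineauVicol2026_rss_liouville`), and is OPEN for `α` of order one and for rotated profiles with local energy estimates but no Type I bound [cite: BradshawTsai2017CPDE, Appendix §5 Open Problems 5.1–5.2] [cite: PineauVicol2026, Conjecture 1.1 (arXiv:2607.09619 p. 3)]; rotated discretely self-similar (RDSS) blow-up is excluded only for extreme `|α|` with factor `λ` close to `1` [cite: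 PineauVicol2026, Theorem 1.7 (arXiv:2607.09619 p. 7)], backward DSS with `λ` away from `1` under no condition at all [cite: ChaeWolf2017RemovingDSS, §1 (arXiv:1610.09464 p. 2)] — see `LeraySelfSimilarBlowupExclusionNarrow`.
scope_caveats: (a) FORMAL scope of the conjuncts: the in-tree facts quantify over `C²` profile pairs `(U, P)` solving Leray's system classically (accepted `Literature.Analysis.FluidPDE.IsLerayProfile`), a specialisation of the printed weak profiles `U ∈ W^{1,2}_loc` of (1.3) [cite: NecasRuzickaSverak1996, Thm. 1 (p. 291)] [cite: Tsai1998, Thm. 1]; the `q = ∞` case of Tsai's Thm. 1 (bounded profiles are constant) is print-only, `Literature.Analysis.FluidPDE.tsai_selfsimilar` taking `3 < q < ∞`; (b) only Leray's EXACT backward self-similar ansatz is excluded by the formal declaration — discretely and asymptotically self-similar scenarios are covered only by the results cited in `evasions_known` [cite: ChaeWolf2017RemovingDSS, Thms. 1.1, 1.3] [cite: Chae2007, Thms. 1.4–1.5], general Type I or Type II singularities not at all, "more complicated singularities may possibly exist" [cite: Tsai1998, §1]; (c) the barrier concerns BLOW-UP profiles: forward self-similar solutions `t^{-1/2}U(x/√t)`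 do exist for every scale-invariant datum locally Hölder off the origin [cite: JiaSverak2014, Thm. 1]; (d) the in-tree docstrings of `tsai_selfsimilar` / `tsai_selfsimilar_local_energy` interchange Tsai's theorem numbers (the statements are the printed ones); (e) (audit 2026-08-16) the technique-class tokens `self-similar-blowup-ansatz` / `exact-self-similar-scenario` are covered ONLY for the non-rotated ansatz (`α = 0`), and `blowup-construction` only in that instance: Perelman's rotated exact self-similar ansatz is open outside extreme angular speed, the corrected entry being `LeraySelfSimilarBlowupExclusionNarrow` below [cite: PineauVicol2026, Conjecture 1.1 and Theorem 1.4 (arXiv:2607.09619 pp. 3–4)] [cite: BradshawTsai2017CPDE, Appendix §5 Open Problems 5.1–5.2]; (f) integrability is load-bearing: with no growth hypothesis Leray's system has the nonzero smooth solutions `U = ∇Φ`, `Φ` harmonic, `P = −½|U|² − a y·U` (e.g. the planar strain `U(y) = y₁e₀ + y₀e₁`, proved below: `exists_isLerayProfile_ne_zero`, `not_isLerayProfile_rigid`), i.e. infinite-energy exactly self-similar blow-ups `u = U(x)/(2a(T−t))` [cite: Tsai1998, Remark 5.4 (p. 49)].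
status: established -/
def LeraySelfSimilarBlowupExclusion : Prop :=
  Literature.Analysis.FluidPDE.necas_ruzicka_sverak ∧ Literature.Analysis.FluidPDE.tsai_selfsimilar ∧ Literature.Analysis.FluidPDE.tsai_selfsimilar_local_energy

/-- Projection: the `L³` case (Nečas–Růžička–Šverák 1996, Thm. 1).
[cite: NecasRuzickaSverak1996, Thm. 1 (p. 291)] -/
theorem LeraySelfSimilarBlowupExclusion.necas_ruzicka_sverak (h : LeraySelfSimilarBlowupExclusion) :
    Literature.Analysis.FluidPDE.necas_ruzicka_sverak :=
  h.1

/-- Projection: the `L^q` case, `3 < q < ∞` (Tsai 1998, Thm. 1). [cite: Tsai1998, Thm. 1] -/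
theorem LeraySelfSimilarBlowupExclusion.tsai_Lq (h : LeraySelfSimilarBlowupExclusion) :
    Literature.Analysis.FluidPDE.tsai_selfsimilar :=
  h.2.1

/-- Projection: the local-energy case (Tsai 1998, Thm. 2). [cite: Tsai1998, Thm. 2] -/
theorem LeraySelfSimilarBlowupExclusion.tsai_localEnergy (h : LeraySelfSimilarBlowupExclusion) :
    Literature.Analysis.FluidPDE.tsai_selfsimilar_local_energy :=
  h.2.2

/-- Conversely the three in-tree facts assemble the barrier fact. [cite: Tsai1998, Thms. 1–2] -/
theorem leraySelfSimilarBlowupExclusion_of (h₁ : Literature.Analysis.FluidPDE.necas_ruzicka_sverak)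
    (h₂ : Literature.Analysis.FluidPDE.tsai_selfsimilar) (h₃ : Literature.Analysis.FluidPDE.tsai_selfsimilar_local_energy) :
    LeraySelfSimilarBlowupExclusion :=
  ⟨h₁, h₂, h₃⟩

/-! ### Audit 2026-08-16 (D-0021): integrability is load-bearing — Tsai's potential profiles (Remark 5.4) -/

section PotentialProfiles

open Literature.Analysis.FluidPDE

/-- Local notation for physical space `ℝ³ = EuclideanSpace ℝ (Fin 3)`. -/
local notation "ℝ³" => EuclideanSpace ℝ (Fin 3)

/-- The planar strain `L y = ⟪e₁, y⟫ e₀ + ⟪e₀, y⟫ e₁ = ∇(y₀ y₁)` as a continuous linear map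
(the simplest instance of Tsai's `U = ∇Φ`, `Φ = y₀y₁` harmonic). [cite: Tsai1998, Remark 5.4 (p. 49)] -/
private def strainL : ℝ³ →L[ℝ] ℝ³ :=
  (innerSL ℝ (EuclideanSpace.single (1 : Fin 3) (1 : ℝ))).smulRight (EuclideanSpace.single (0 : Fin 3) (1 : ℝ)) +
    (innerSL ℝ (EuclideanSpace.single (0 : Fin 3) (1 : ℝ))).smulRight (EuclideanSpace.single (1 : Fin 3) (1 : ℝ))

/-- Unfolding the strain map. [folklore] -/
private theorem strainL_apply (y : ℝ³) :
    strainL y = ⟪EuclideanSpace.single (1 : Fin 3) (1 : ℝ), y⟫ • EuclideanSpace.single (0 : Fin 3) (1 : ℝ) +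
      ⟪EuclideanSpace.single (0 : Fin 3) (1 : ℝ), y⟫ • EuclideanSpace.single (1 : Fin 3) (1 : ℝ) := by
  simp [strainL]

/-- The strain map is symmetric. [folklore] -/
private theorem inner_strainL_comm (u v : ℝ³) : ⟪u, strainL v⟫ = ⟪strainL u, v⟫ := by
  simp only [strainL_apply, inner_add_right, inner_add_left, inner_smul_right, inner_smul_left,
    real_inner_comm, RCLike.conj_to_real]
  ring

/-- `L e₁ = e₀` (so `L ≠ 0`). [folklore] -/
private theorem strainL_single_one :
    strainL (EuclideanSpace.single (1 : Fin 3) (1 : ℝ)) = EuclideanSpace.single (0 : Fin 3) (1 : ℝ) := by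
  rw [strainL_apply]
  simp [EuclideanSpace.inner_single_left]

/-- `tr L = 0`: the strain field is divergence free. [folklore] -/
private theorem divergence_strainL (x : ℝ³) : VectorCalculus.divergence (strainL : ℝ³ → ℝ³) x = 0 := by
  rw [divergence_eq_sum_inner_fderiv (EuclideanSpace.basisFun (Fin 3) ℝ), ContinuousLinearMap.fderiv]
  simp [Fin.sum_univ_three, strainL_apply, inner_add_right, EuclideanSpace.inner_single_left]

/-- A linear field is harmonic. [folklore] -/
private theorem laplacian_strainL (x : ℝ³) : (Δ (strainL : ℝ³ → ℝ³)) x = 0 := by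
  rw [laplacian_eq_sum_fderiv_fderiv (stdOrthonormalBasis ℝ ℝ³) strainL.contDiff x]
  simp

/-- Tsai's pressure `P = −½|Ly|² − a ⟪y, Ly⟫`, making `Π = ½|U|² + P + a y·U ≡ 0`.
[cite: Tsai1998, Remark 5.4 (p. 49)] -/
private def strainP (a : ℝ) (y : ℝ³) : ℝ := -(1 / 2) * ‖strainL y‖ ^ 2 - a * ⟪y, strainL y⟫

/-- The Fréchet derivative of the pressure in dual form: `DP(y) h = ⟪−L(Ly) − 2a Ly, h⟫`
(symmetry of `L`). [folklore] -/
private theorem hasFDerivAt_strainP (a : ℝ) (y : ℝ³) :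
    HasFDerivAt (strainP a)
      (InnerProductSpace.toDual ℝ ℝ³ (-(strainL (strainL y)) - (2 * a) • strainL y)) y := by
  have h1 := (strainL.hasFDerivAt (x := y)).norm_sq
  have h2 := (hasFDerivAt_id y).inner ℝ (strainL.hasFDerivAt (x := y))
  have h := (h1.const_mul (-(1 / 2) : ℝ)).sub (h2.const_mul a)
  refine h.congr_fderiv ?_
  ext v
  simp only [InnerProductSpace.toDual_apply_apply, FunLike.coe_sub, Pi.sub_apply,
    FunLike.coe_smul, Pi.smul_apply, two_smul, add_apply,
    ContinuousLinearMap.comp_apply, innerSL_apply_apply, fderivInnerCLM_apply, ContinuousLinearMap.prod_apply,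
    ContinuousLinearMap.coe_id', id_eq, smul_eq_mul, inner_sub_left, inner_neg_left, inner_smul_left,
    RCLike.conj_to_real]
  rw [real_inner_comm (strainL y) v, ← inner_strainL_comm (strainL y) v, ← inner_strainL_comm y v]
  ring

/-- `∇P(y) = −L(Ly) − 2a Ly`. [folklore] -/
private theorem gradient_strainP (a : ℝ) (y : ℝ³) :
    gradient (strainP a) y = -(strainL (strainL y)) - (2 * a) • strainL y :=
  (hasGradientAt_iff_hasFDerivAt.2 (hasFDerivAt_strainP a y)).gradient

/-- The pressure is `C¹` (indeed a quadratic polynomial). [folklore] -/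
private theorem contDiff_strainP (a : ℝ) : ContDiff ℝ 1 (strainP a) := by
  unfold strainP
  exact ((contDiff_const.mul (strainL.contDiff.norm_sq ℝ)).sub
    (contDiff_const.mul (contDiff_id.inner ℝ strainL.contDiff)))

/-- The strain pair solves Leray's profile system `IsLerayProfile ν a` for EVERY `ν`, `a`:
`−νΔU = 0`, `aU + a(y·∇)U = 2aLy`, `(U·∇)U = L(Ly)`, `∇P = −L(Ly) − 2aLy`, `div U = tr L = 0`.
[cite: Tsai1998, Remark 5.4 (p. 49)] -/
private theorem isLerayProfile_strain (ν a : ℝ) : IsLerayProfile ν a (strainL : ℝ³ → ℝ³) (strainP a) where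
  contDiff_velocity := strainL.contDiff
  contDiff_pressure := contDiff_strainP a
  profile_eq y := by
    rw [laplacian_strainL, ContinuousLinearMap.fderiv, convect_apply, ContinuousLinearMap.fderiv,
      gradient_strainP]
    simp only [smul_zero, neg_zero, zero_add]
    module
  divFree := divergence_strainL

/-- **Tsai's potential profiles (Tsai 1998, Remark 5.4): without a growth or integrability
hypothesis Leray's profile system has nonzero smooth solutions.** For every viscosity `ν` and
rate `a` there is a `C²` pair `(U, P)` solving `−νΔU + aU + a(y·∇)U + (U·∇)U + ∇P = 0`,
`div U = 0` on `ℝ³` (`IsLerayProfile ν a U P`) with `U ≠ 0` — here the planar strain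
`U(y) = y₁e₀ + y₀e₁ = ∇(y₀y₁)` with `P = −½|U|² − a y·U` (so that `Π ≡ 0`), an instance of "Let
`Φ` be an arbitrary harmonic function on `ℝ³`. Let `U = ∇Φ` and `P = −½|U|² − ay·U` … Then
`(U, P)` satisfies Leray's equations (1.3)". The corresponding exactly self-similar blow-up
`u = U(x)/(2a(T−t))` has infinite energy. Hence the hypotheses `U ∈ L³` / `U ∈ L^q` / local
energy estimates of the three conjuncts of `LeraySelfSimilarBlowupExclusion` are load-bearing
(scope caveat (f)). [cite: Tsai1998, Remark 5.4 (p. 49)] -/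
theorem exists_isLerayProfile_ne_zero (ν a : ℝ) :
    ∃ (U : ℝ³ → ℝ³) (P : ℝ³ → ℝ), IsLerayProfile ν a U P ∧ U ≠ 0 := by
  refine ⟨strainL, strainP a, isLerayProfile_strain ν a, fun h => ?_⟩
  have h1 := congr_fun h (EuclideanSpace.single (1 : Fin 3) (1 : ℝ))
  rw [strainL_single_one] at h1
  have h2 := congr_fun (congrArg (⇑) h1) (0 : Fin 3)
  simp at h2

/-- Consequently the integrability-free strengthening of `Literature.Analysis.FluidPDE.necas_ruzicka_sverak`
is false: Leray profiles are not rigid by the equation alone (so no barrier covers "exactly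
self-similar profiles" without a decay / local-energy qualification). [cite: Tsai1998, Remark 5.4 (p. 49)] -/
theorem not_isLerayProfile_rigid :
    ¬ ∀ (ν a : ℝ), 0 < ν → 0 < a → ∀ (U : ℝ³ → ℝ³) (P : ℝ³ → ℝ), IsLerayProfile ν a U P → U = 0 := by
  intro h
  obtain ⟨U, P, hprof, hU⟩ := exists_isLerayProfile_ne_zero 1 1
  exact hU (h 1 1 one_pos one_pos U P hprof)

end PotentialProfiles

/-! ### Audit 2026-08-16 (D-0021): the narrowed entry — Leray's ansatz, plus Perelman's rotated ansatz at extreme angular speed -/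

/-- **Narrowed barrier (audit 2026-08-16): exactly self-similar blow-up is excluded for Leray's
NON-ROTATED ansatz (Nečas–Růžička–Šverák 1996; Tsai 1998) and, among ROTATED exactly
self-similar scenarios — Perelman's ansatz `u(x,t) = (−t)^{−1/2} R(αs) U(R(−αs)x/√(−t))`,
`s = −log(−t)` — at extreme angular speed under a Type I bound (Pineau–Vicol 2026,
Thm. 1.4).** The conjunction of `LeraySelfSimilarBlowupExclusion` (a theorem of the tree:
`LeraySelfSimilarBlowupExclusion_holds` in the Proofs companion) with the named fact
`Literature.Analysis.FluidPDE.pineauVicol2026_rss_liouville` (a printed theorem, discharged in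
the tree as `Literature.Analysis.FluidPDE.pineauVicol2026_rss_liouville_holds`; the conjunction
is `LeraySelfSimilarBlowupExclusionNarrow_holds` in the Proofs companion): for every
`C₀ > 0` there are `α₁, α₂ > 0` such that a classical solution (`ν = 1`) on the time set
`[−1,0)` with `‖u(t,x)‖ ≤ C₀/(‖x‖ + √(−t))` which is rotated self-similar about the `e₃`-axis
with a `C²` profile `U` and angular speed `|α| < α₁` or `|α| > α₂` has `U ≡ 0`
[cite: PineauVicol2026, Theorem 1.4 (arXiv:2607.09619 p. 4)]. This conjunction is the extent
of the catalogue's "exact self-similar scenario" class that the printed theorems actually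
reach (2026-08): the rotated ansatz with `α` of order one relative to `C₀`, or with local
energy estimates but no pointwise Type I bound, lies OUTSIDE every theorem in print
(Perelman's question) [cite: BradshawTsai2017CPDE, Appendix §5 (arXiv:1610.05680 p. 14)]
[cite: PineauVicol2026, §1.2, (1.9) and the sentence after Theorem 1.4 (arXiv:2607.09619 pp. 3–4)].

BARRIER (structured block, D-0021):
technique_class: leray-backward-self-similar-profile exact-nonrotated-self-similar-scenario rotated-self-similar-profile-extreme-angular-speed perelman-rss-ansatz-extreme-alpha
blocks: the negation ¬NavierStokesRegularity via an EXACTLY self-similar singularity in either of the two decay-compatible exact symmetry reductions through the scaling: (i) Leray's ansatz `u = (2a(T−t))^{−1/2} U(x/√(2a(T−t)))` with `U ∈ L³`, `U ∈ L^q` (`3 < q < ∞`) or local energy estimates near the singular point [cite: NecasRuzickaSverak1996, Thm. 1 (p. 291)] [cite: Tsai1998, Thms. 1–2 (p. 31)]; (ii) Perelman's rotated ansatz `u = (−t)^{−1/2} R(αs) U(R(−αs)x/√(−t))`, `s = −log(−t)`, under the Type I bound `|u| ≤ C₀/(|x| + √(−t))` — equivalently `|U(y)| ≤ C₀/(1+|y|)`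 [cite: PineauVicol2026, Remark 1.2 (arXiv:2607.09619 pp. 3–4)] — when `|α| < α_(C₀)` or `|α| > ᾱ(C₀)` [cite: PineauVicol2026, Theorem 1.4 (arXiv:2607.09619 p. 4)]; in both reductions a profile `U ∈ L³` — in particular any finite-energy, finite-dissipation exactly (rotated-)self-similar slab, for which `U ∈ H¹ ⊂ L³` [cite: NecasRuzickaSverak1996, §1 (pp. 283–284)] — is excluded for every `α` through `u ∈ L^∞_t L³_x` regularity [cite: BradshawTsai2017CPDE, Appendix §5 (arXiv:1610.05680 p. 14)] [cite: PineauVicol2026, §1.2 p. 4].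
because: (i) for `α = 0` the head pressure `Π = ½|U|² + P + a y·U` satisfies `−νΔΠ + (U + ay)·∇Π = −ν|curl U|² ≤ 0`, and a Liouville lemma for this drift operator makes `Π` constant under polynomial growth, whence `U = 0` [cite: NecasRuzickaSverak1996, Lemma 3.3 and Thm. 1 (pp. 290–291)] [cite: Tsai1998, (1.7), Lemma 5.1 and §5 (pp. 31, 47–49)]; (ii) for `α ≠ 0` the antisymmetric rotation terms destroy this structure, and Pineau–Vicol replace it by a quantitative weighted-`L²` framework, perturbative for `|α| ≪ 1` and exploiting the fast rotation for `|α| ≫ 1` [cite: PineauVicol2026, §1.2 (arXiv:2607.09619 pp. 4–5)].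
evasions_known: NOT reached by any theorem in print, hence NOT blocked: Perelman's rotated exact self-similar blow-up with `α` of order one relative to the Type I constant ("leaves … the case `α ≈ 1`") [cite: PineauVicol2026, sentence after Theorem 1.4 and §1.2 (1.9) (arXiv:2607.09619 pp. 3–4)] [cite: BradshawTsai2017CPDE, Appendix §5, Perelman's RSS question 5.2 (arXiv:1610.05680 p. 14)]; rotated profiles (any `α ≠ 0`) with local energy estimates but no pointwise Type I bound — Tsai's class (1.4) has no rotated counterpart in print [cite: BradshawTsai2017CPDE, Appendix §5, question 5.1 (arXiv:1610.05680 p. 14)]; backward DSS blow-up with factor `λ` away from `1`, and RDSS outside extreme `|α|` with `λ` near `1` [cite: ChaeWolf2017RemovingDSS, §1 and Thm. 1.3 (arXiv:1610.09464 pp. 2–3)] [cite: PineauVicol2026, Theorems 1.6–1.7 (arXiv:2607.09619 pp. 6–7)]; backward self-similar profiles in the half-space with Type I decay [cite: BradshawTsai2017CPDE, Appendix §5, question 5.3 (arXiv:1610.05680 p. 14)]; and everything listed under the original entry (asymptotically self-similar excluded [cite: Chae2007, Thms. 1.4–1.5]; Type II untouched; axisymmetric singularities are Type II [cite: KochNadirashviliSereginSverak2009,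 §1 and Thm. 6.2] — a genuinely rotating profile is necessarily non-axisymmetric, the rotated ansatz of an axisymmetric field being Leray's [cite: BradshawTsai2017CPDE, §1 (arXiv:1610.05680 p. 4)]).
scope_caveats: (a) FORMAL status: both conjuncts are theorems of the tree — the first is `LeraySelfSimilarBlowupExclusion_holds` (over `C²` profiles `Literature.Analysis.FluidPDE.IsLerayProfile`); the second, a named fact whose printed proof is an arXiv preprint (v2 of 6 Aug 2026, unrefereed) [cite: PineauVicol2026, Theorem 1.4], is rendered for `ν = 1`, blow-up time `0`, rate `a = ½`, classical solutions with an explicit smooth pressure on the time set `[−1,0)`, rotation about the `e₃`-axis (`Literature.Analysis.FluidPDE.rotZ`; a general axis by conjugation, not formalised) and `U ∈ C²`, and is discharged in that rendering (`Literature.Analysis.FluidPDE.pineauVicol2026_rss_liouville_holds`) not by the printed weighted-`L²` estimates of §§5–6 but by the compactness argument of Chae–Wolf 2017, §3 for both extreme ranges of `α`, ending in Tsai's Thm. 1 — the alternative proof the source itself names for `|α| ≫ 1` [cite: PineauVicol2026, p. 6 (arXiv:2607.09619), before Theorem 1.6] [cite: ChaeWolf2017RemovingDSS, Thm. 1.3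 and §3 (arXiv:1610.09464 pp. 3, 8–9)], run with `α_n → 0` for `|α| ≪ 1`; its `α = 0` slice is also proved directly from Tsai's Thm. 1 (`Literature.Analysis.FluidPDE.pineauVicol2026_rss_liouville_alpha_zero`); the thresholds `α_(C₀)`, `ᾱ(C₀)` are existential, with no size information, in print as in the tree; (b) the other one-parameter twists of the scaling — Galilean boosts in logarithmic time — force a pressure linear in `x` and are incompatible with spatial decay, and twisting by a translation only recentres the singularity, so (i)–(ii) and their discrete versions DSS/RDSS exhaust the decay-compatible exact self-similar ansätze [folklore]; (c) integrability/decay is load-bearing in both conjuncts: `U = ∇Φ`, `Φ` harmonic, solves Leray's system with `P = −½|U|² − a y·U` (`exists_isLerayProfile_ne_zero` above) [cite: Tsai1998, Remark 5.4 (p. 49)]; (d) forward (expanding) self-similar, RSS, DSS and RDSS solutions exist for large data and are not blow-up profiles [cite: JiaSverak2014, Thm. 1] [cite: BradshawTsai2017CPDE, Thm. 1.3].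
status: established — both conjuncts theorems of the tree (`LeraySelfSimilarBlowupExclusionNarrow_holds`); the rotated conjunct is a printed theorem (2026 preprint) vendored as the named fact `pineauVicol2026_rss_liouville` and discharged as `pineauVicol2026_rss_liouville_holds` [cite: PineauVicol2026, Theorem 1.4] -/
def LeraySelfSimilarBlowupExclusionNarrow : Prop :=
  LeraySelfSimilarBlowupExclusion ∧ Literature.Analysis.FluidPDE.pineauVicol2026_rss_liouville

/-- Projection: the non-rotated (Leray) part of the narrowed entry. [cite: NecasRuzickaSverak1996, Thm. 1 (p. 291)] -/
theorem LeraySelfSimilarBlowupExclusionNarrow.leray (h : LeraySelfSimilarBlowupExclusionNarrow) :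
    LeraySelfSimilarBlowupExclusion :=
  h.1

/-- Projection: the rotated part at extreme angular speed (Pineau–Vicol 2026, Thm. 1.4).
[cite: PineauVicol2026, Theorem 1.4 (arXiv:2607.09619 p. 4)] -/
theorem LeraySelfSimilarBlowupExclusionNarrow.rss_extreme_alpha
    (h : LeraySelfSimilarBlowupExclusionNarrow) :
    Literature.Analysis.FluidPDE.pineauVicol2026_rss_liouville :=
  h.2

/-- The narrowed entry from its two conjuncts; with `LeraySelfSimilarBlowupExclusion_holds` and
`Literature.Analysis.FluidPDE.pineauVicol2026_rss_liouville_holds` it gives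
`LeraySelfSimilarBlowupExclusionNarrow_holds` (Proofs companion).
[cite: PineauVicol2026, Theorem 1.4 (arXiv:2607.09619 p. 4)] -/
theorem leraySelfSimilarBlowupExclusionNarrow_of (h₁ : LeraySelfSimilarBlowupExclusion)
    (h₂ : Literature.Analysis.FluidPDE.pineauVicol2026_rss_liouville) :
    LeraySelfSimilarBlowupExclusionNarrow :=
  ⟨h₁, h₂⟩

/-- The narrowed entry implies the original one (the narrowing concerns the CLAIMED technique
class, not the truth of the original conjunction). [cite: Tsai1998, Thms. 1–2 (p. 31)] -/
theorem LeraySelfSimilarBlowupExclusionNarrow.toLeraySelfSimilarBlowupExclusion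
    (h : LeraySelfSimilarBlowupExclusionNarrow) : LeraySelfSimilarBlowupExclusion :=
  h.leray

end Literature.Barriers.NavierStokesRegularity
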